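import Summits.CriticalPhenomena.PercolationContinuityZ3.Theorems.PercNearOneGluingNoHeavyLowerTailSwitchRelaxQuartic
import HarnessLib

/-!
# `NoHeavyLowerTail` (stmt-CriticalPhenomena-4575) — spectator slicing, III c′: the LIST form of `quartic_sound`

Support file (prover prim-masterthm-p1 gen 3; `--supports stmt-CriticalPhenomena-4575`).  No named facts, no sorries.

`…SwitchRelaxQuartic.quartic_sound` takes the fifteen slice certificates as a function `Ty → Cert`.  A measure file assembles
them from fifteen data-file constants, and the cheap way to do that without definitional unfolding battles in the elaborator is
a literal LIST with `List.Forall₂` hypotheses built by `List.Forall₂.cons` chains (the pattern of part IId's `TPb_ok`).  This file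
provides that list interface: `forall₂_getN` (transport of a `Forall₂` relation to `getN`-indexed entries) and
`quartic_sound_list`.
-/

namespace Summit.CriticalPhenomena.PercolationContinuityZ3.Theorems

namespace SwitchRelax

open Finset FourPointAtoms
open scoped BigOperators

/-- A `Forall₂` relation holds between the `getN`-indexed entries (inside the range). [folklore] -/
theorem forall₂_getN {α β : Type} {R : α → β → Prop} :
    ∀ {l₁ : List α} {l₂ : List β}, List.Forall₂ R l₁ l₂ → ∀ (n : ℕ) (d₁ : α) (d₂ : β), n < l₁.length →
      R (getN l₁ n d₁) (getN l₂ n d₂)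
  | _, _, List.Forall₂.nil, n, _, _, h => absurd h (by simp)
  | _, _, List.Forall₂.cons hab _, 0, _, _, _ => by simpa only [getN] using hab
  | _, _, List.Forall₂.cons _ hl, n + 1, d₁, d₂, h => by
      simp only [getN]
      exact forall₂_getN hl n d₁ d₂ (by simpa using h)

/-- **List form of the soundness of the quartic check.**  The fifteen slice certificates as a literal list `cs` (indexed by the
spectator type in `FourPointAtoms.pat4` order), their tables as aligned lists, `Forall₂`-shaped table hypotheses, and
`ES c P ≤ 0` for every member: then the cell-level `E₄` is nonnegative. [this work] -/
theorem quartic_sound_list (cs : List Cert) (c₀ : Cert) {T0s TPs : List (List (List (List ℤ)))}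
    (hT0 : List.Forall₂ (fun c T => ∀ πX : Ty, TabOK (c.lam0 πX) (getN T πX.val [])) cs T0s)
    (hTP : List.Forall₂ (fun c TP => List.Forall₂ (fun p T => TabOK p.lam T) c.progs TP) cs TPs)
    (hlen : cs.length = 15) {D : ℤ} {E : E4Lists} (h0 : quarticCheck0 D E = true)
    (hchk : ∀ q₀ : Ty, quarticCheckAt T0s TPs D E q₀ = true) (P : Ty → ℝ) (hσ : ∑ i, P i = 1) (hP : ∀ i, 0 ≤ P i)
    (hES : ∀ c ∈ cs, ES c P ≤ 0) : 0 ≤ E4cell E P := by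
  have hlt : ∀ q : Ty, q.val < cs.length := fun q => lt_of_lt_of_eq q.isLt hlen.symm
  exact quartic_sound (fun q => getN cs q.val c₀)
    (fun q πX => forall₂_getN hT0 q.val c₀ [] (hlt q) πX)
    (fun q => forall₂_getN hTP q.val c₀ [] (hlt q)) h0 hchk P hσ hP
    (fun q => hES _ (getN_mem cs q.val c₀ (hlt q)))

end SwitchRelax

end Summit.CriticalPhenomena.PercolationContinuityZ3.Theorems
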